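import Summits.AnomalousDissipation.AnomalousDissipation.Theorems.SolenoidalFractalHomogenisationLagrangianStepVmodFlatPointwise
import Summits.AnomalousDissipation.AnomalousDissipation.Theorems.SolenoidalFractalHomogenisationLagrangianStepVmodSSModeGrid
import HarnessLib

/-!
# K1L_D (stmt-AnomalousDissipation-27980): (V_mod) flat stage — the (ss) BLOCK INEQUALITY ON GRID-ANCHORED WINDOWS
(helper; `--supports 27980 --as helper`; prover ad-sawtooth-k1loc-p1 g15.)

The two landed reductions `blockBound_slowNZ_of_ssMode_at` / `blockBound_slow_of_slowNZ_at` (…VmodFlatPointwise, ad-k1loc-p3 g9; bodies = p1 g14's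
`bssNZ_of_ssMode` / `bss_of_bssNZ`) use their hypothesis only at the window `(s,t)` being estimated.  §1 states them WINDOW-LOCALLY (same bodies, the
`∀ window` intro removed; every text-level form — `…E`, `…EH`, grid-anchored — is a corollary); §2 combines them with `VmodGen.ssMode_grid` into the
(ss) block inequality `|⟪(U−T)(s,t)x, ζ⟫| ≤ (C₁(C₁(ν^e+(⌈K/ν⌉/n)^e) + (min 1 (P/(t−s)))^e))·√lossFwd·√lossAdj` for slow `x, ζ` on GRID-ANCHORED windows
(`∃ j : ℕ, s = j·(M·W.period/ν)`), i.e. the body of `BlockBound … IsSlow IsSlow` with that one extra binder (`inner_sub_le_slow_grid`).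
NOT a proof of `Bss_textEH` (all `s ≥ 0`; see finding F-p1g15-1: its antecedents are time-0-anchored), of the stub, of K1L_D or of AD; rung F-D1.A0.
-/

set_option linter.dupNamespace false

noncomputable section

namespace Summit.AnomalousDissipation.AnomalousDissipation.Theorems.SolenoidalFractalHomogenisation.LagrangianStep.VmodFlat

open Literature.Analysis Literature.Analysis.FluidPDE Literature.Analysis.FunctionSpaces
open MeasureTheory Set Filter UnitAddTorus
open scoped ENNReal NNReal InnerProductSpace
open Summit.AnomalousDissipation.AnomalousDissipation.Theorems.SolenoidalFractalHomogenisation.LagrangianStep.CellClauseMod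
open Summit.AnomalousDissipation.AnomalousDissipation.Theorems.SolenoidalFractalHomogenisation.LagrangianStep.LossCurrency
open Summit.AnomalousDissipation.AnomalousDissipation.Theorems.SolenoidalFractalHomogenisation.RealisedQuasiStaticCellLaw

/-! ## §1 The two reductions, window-locally -/

set_option maxHeartbeats 1600000 in
/-- **Window-local (ss-mode) ⇒ (ss) on nonzero slow data** (the body of `blockBound_slowNZ_of_ssMode_at` at ONE window `(s,t)`). -/
theorem abs_inner_sub_le_of_ssMode_window {k : ℕ} (W : LatticeShear.LatticeWord k) (M : ℝ) (hM : 0 < M) {c : ℝ} (hc : 0 < c)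
    (Φ : ℝ → Torus.Visc4 (Fin 3) → Torus.Visc4 (Fin 3)) {lo hi Λ σ' C₁ ν₀ K : ℝ} (hlo : 0 < lo) (hΛ : 1 < Λ) (hK : 0 < K) (hC₁ : 0 ≤ C₁)
    {ν : ℝ} (hν : ν ∈ Set.Ioo 0 ν₀) {n : ℕ} (hn : (⌈K / ν⌉₊ : ℝ) ≤ n) {𝔸 : Torus.Visc4 (Fin 3)}
    (hwin : ∃ lam ∈ Set.Icc (1:ℝ) Λ, Torus.NearIso 𝔸 (ν * (lo / lam)) (ν * (hi * lam)))
    (hΦw : ∃ lam ∈ Set.Icc (1:ℝ) Λ, Torus.NearIso (Φ ν ((1 / ν) • 𝔸)) (lo / lam) (hi * lam))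
    {Tw : ℝ} {U T : ℝ → ℝ → (V2 →L[ℝ] V2)}
    (hU : Torus.IsPropagator Tw (cellField W M hM ν hν.1 n) ((1 / (n:ℝ) ^ 2) • 𝔸) U)
    (hT : Torus.IsPropagator Tw (fun _ _ => 0) ((1 / (n:ℝ) ^ 2) • (𝔸 + (c / ν) • Φ ν ((1 / ν) • 𝔸))) T)
    {s t : ℝ} (hs : 0 ≤ s) (hst : s < t) (htT : t ≤ Tw)
    (hmode : ∀ ℓ ∈ (Torus.freqBall (d := Fin 3) (n / 4)).erase 0, ∀ v : V2, v ∈ Torus.divFreeL2 (Fin 3) →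
        (∀ k', k' ≠ ℓ → k' ≠ -ℓ → fc v k' = 0) →
        ‖fc (U s t v - T s t v) ℓ‖ ≤ (C₁ * (C₁ * (ν ^ σ' + ((⌈K / ν⌉₊ : ℝ) / n) ^ σ') + (min 1 ((M * W.period / ν) / (t - s))) ^ σ')) * dW lo Λ c ν n (t - s) ℓ * ‖fc v ℓ‖)
    (x ζ : V2) (hx : IsSlowNZ n x) (hζ : IsSlowNZ n ζ) :
    |⟪U s t x - T s t x, ζ⟫_ℝ| ≤ (C₁ * (C₁ * (ν ^ σ' + ((⌈K / ν⌉₊ : ℝ) / n) ^ σ') + (min 1 ((M * W.period / ν) / (t - s))) ^ σ')) * Real.sqrt (lossFwd (T s t) x) * Real.sqrt (lossAdj (T s t) ζ) := by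
  -- the resolution `n ≥ 1` and the slow set
  have hn1 : (1:ℝ) ≤ n := by
    have h1 : (1:ℝ) ≤ ⌈K / ν⌉₊ := by
      have : 0 < K / ν := div_pos hK hν.1
      exact_mod_cast Nat.one_le_iff_ne_zero.2 (Nat.pos_iff_ne_zero.1 (Nat.ceil_pos.2 this))
    exact h1.trans hn
  have hnpos : 0 < n := by exact_mod_cast (show (0:ℝ) < n by linarith)
  have hn0 : (0:ℝ) < n := by exact_mod_cast hnpos
  set S : Finset (Fin 3 → ℤ) := (Torus.freqBall (d := Fin 3) (n / 4)).erase 0 with hS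
  have hLN : 2 * (n / 4) < n := by omega
  -- ellipticity windows of the two members
  obtain ⟨lam, hlam, hA𝔸⟩ := hwin
  obtain ⟨lam', hlam', hΦn⟩ := hΦw
  have hlam0 : 0 < lam := by linarith [hlam.1]
  have hlam'0 : 0 < lam' := by linarith [hlam'.1]
  have hcν : 0 ≤ c / ν := div_nonneg hc.le hν.1.le
  have hn2 : (0:ℝ) < 1 / (n:ℝ) ^ 2 := by positivity
  have hcell : Torus.NearIso ((1 / (n:ℝ) ^ 2) • 𝔸) ((1 / (n:ℝ) ^ 2) * (ν * (lo / lam))) ((1 / (n:ℝ) ^ 2) * (ν * (hi * lam))) :=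
    hA𝔸.smul hn2.le
  have hcell_lo : 0 < (1 / (n:ℝ) ^ 2) * (ν * (lo / lam)) := mul_pos hn2 (mul_pos hν.1 (div_pos hlo hlam0))
  have hcoarse0 : Torus.NearIso ((1 / (n:ℝ) ^ 2) • (𝔸 + (c / ν) • Φ ν ((1 / ν) • 𝔸)))
      ((1 / (n:ℝ) ^ 2) * (ν * (lo / lam) + (c / ν) * (lo / lam'))) ((1 / (n:ℝ) ^ 2) * (ν * (hi * lam) + (c / ν) * (hi * lam'))) :=
    (hA𝔸.add (hΦn.smul hcν)).smul hn2.le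
  -- weaken the lower constant to the uniform `loT`
  have hloT_le : loT lo Λ c ν n ≤ (1 / (n:ℝ) ^ 2) * (ν * (lo / lam) + (c / ν) * (lo / lam')) := by
    unfold loT
    have h1 : lo / Λ ≤ lo / lam := div_le_div_of_nonneg_left hlo.le hlam0 hlam.2
    have h2 : lo / Λ ≤ lo / lam' := div_le_div_of_nonneg_left hlo.le hlam'0 hlam'.2
    have h3 : (ν + c / ν) * (lo / Λ) ≤ ν * (lo / lam) + (c / ν) * (lo / lam') := by
      have := mul_le_mul_of_nonneg_left h1 hν.1.le
      have := mul_le_mul_of_nonneg_left h2 hcν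
      nlinarith
    exact mul_le_mul_of_nonneg_left h3 hn2.le
  have hΛ0 : 0 < Λ := by linarith
  have hloT : 0 < loT lo Λ c ν n := by
    unfold loT
    have hνc : 0 < ν + c / ν := by have := hν.1; positivity
    exact mul_pos hn2 (mul_pos hνc (div_pos hlo hΛ0))
  have hcoarse : Torus.NearIso ((1 / (n:ℝ) ^ 2) • (𝔸 + (c / ν) • Φ ν ((1 / ν) • 𝔸)))
      (loT lo Λ c ν n) ((1 / (n:ℝ) ^ 2) * (ν * (hi * lam) + (c / ν) * (hi * lam'))) := hcoarse0.mono hloT_le le_rfl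
  -- class preservation of the cell member (grid-periodic carrier) and of the coarse member (Fourier multiplier)
  have hbU : MemLp (Torus.stLift (cellField W M hM ν hν.1 n)) ∞ (volume.restrict (Ioo 0 Tw ×ˢ (univ : Set (EuclideanSpace ℝ (Fin 3))))) :=
    memLp_top_stLift_cell _ n Tw
  have hbUdiv : ∀ᵐ τ ∂(volume.restrict (Ioo (0:ℝ) Tw)), Torus.IsWeaklyDivFree (cellField W M hM ν hν.1 n τ) :=
    ae_of_all _ fun τ => (isDivFree_cell _ n τ).isWeaklyDivFree_holds (isSmooth_cell _ n τ)
  have hgrid : ∀ (j : Fin 3 → Fin n) (τ : ℝ) (y : UnitAddTorus (Fin 3)),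
      cellField W M hM ν hν.1 n τ (y + (fun i => ((((j i : ℕ) : ℝ) / n : ℝ) : UnitAddCircle))) = cellField W M hM ν hν.1 n τ y :=
    fun j τ y => by unfold cellField; exact cell_add_grid _ hnpos j τ y
  have hUcl : ∀ (c' : Fin 3 → ℤ) (y : V2), (∀ k', ((∀ i, (n:ℤ) ∣ k' i - c' i) ∨ (∀ i, (n:ℤ) ∣ k' i + c' i)) →
        mFourierCoeff (EuclideanSpace.complexify ∘ ⇑y) k' = 0) →
      ∀ k', ((∀ i, (n:ℤ) ∣ k' i - c' i) ∨ (∀ i, (n:ℤ) ∣ k' i + c' i)) →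
        mFourierCoeff (EuclideanSpace.complexify ∘ ⇑(U s t y)) k' = 0 :=
    fun c' y hy k' hk' => PropagatorSymm.fcoeff_apply_eq_zero_of_classes hU hcell hcell_lo hbU hbUdiv hnpos hgrid c' hs hst.le htT y hy k' hk'
  have hTcl : ∀ (c' : Fin 3 → ℤ) (y : V2), (∀ k', ((∀ i, (n:ℤ) ∣ k' i - c' i) ∨ (∀ i, (n:ℤ) ∣ k' i + c' i)) →
        mFourierCoeff (EuclideanSpace.complexify ∘ ⇑y) k' = 0) →
      ∀ k', ((∀ i, (n:ℤ) ∣ k' i - c' i) ∨ (∀ i, (n:ℤ) ∣ k' i + c' i)) →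
        mFourierCoeff (EuclideanSpace.complexify ∘ ⇑(T s t y)) k' = 0 :=
    fun c' y hy k' hk' => fc_propagator_eq_zero hcoarse hloT (fun _ _ => rfl) hT hs hst.le htT y (hy k' hk')
  -- slow nonzero modes are alone in their class pairs and not self-conjugate
  have halone : ∀ ℓ ∈ S, ∀ k' ∈ S, ((∀ i, (n:ℤ) ∣ k' i - ℓ i) ∨ (∀ i, (n:ℤ) ∣ k' i + ℓ i)) → k' = ℓ ∨ k' = -ℓ :=
    fun ℓ hℓ k' hk' hpair => FlatWindow.alone_of_lt hLN (Finset.mem_of_mem_erase hℓ) (Finset.mem_of_mem_erase hk') hpair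
  have hnsc : ∀ ℓ ∈ S, ¬ (∀ i, (n:ℤ) ∣ ℓ i + ℓ i) :=
    fun ℓ hℓ => FlatWindow.not_selfConj_of_lt hLN (Finset.mem_of_mem_erase hℓ) (Finset.ne_of_mem_erase hℓ)
  -- the modewise bound with `ε_ℓ = η · d_ℓ`
  set η : ℝ := C₁ * (C₁ * (ν ^ σ' + ((⌈K / ν⌉₊ : ℝ) / n) ^ σ') + (min 1 ((M * W.period / ν) / (t - s))) ^ σ') with hη
  have hP0 : 0 ≤ (M * W.period / ν) / (t - s) :=
    div_nonneg (div_nonneg (mul_nonneg hM.le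
      (Summit.AnomalousDissipation.AnomalousDissipation.Theorems.SolenoidalFractalHomogenisation.PermissibleCarrier.period_pos W).le) hν.1.le)
      (by linarith)
  have hη0 : 0 ≤ η := by
    have h1 : 0 ≤ ν ^ σ' := Real.rpow_nonneg hν.1.le _
    have h2 : 0 ≤ ((⌈K / ν⌉₊ : ℝ) / n) ^ σ' := Real.rpow_nonneg (by positivity) _
    have h3 : 0 ≤ (min 1 ((M * W.period / ν) / (t - s))) ^ σ' := Real.rpow_nonneg (le_min zero_le_one hP0) _
    rw [hη]; exact mul_nonneg hC₁ (by positivity)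
  set dd : (Fin 3 → ℤ) → ℝ := fun ℓ => dW lo Λ c ν n (t - s) ℓ with hdd
  have hdd0 : ∀ ℓ, 0 ≤ dd ℓ := fun ℓ => by
    rw [hdd]; unfold dW
    have : Real.exp (-(8 * Real.pi ^ 2 * loT lo Λ c ν n * Torus.freqNormSq ℓ * (t - s))) ≤ 1 := by
      apply Real.exp_le_one_iff.2
      have := Real.pi_pos; have := Torus.freqNormSq_nonneg ℓ; have h2 : 0 ≤ t - s := by linarith
      have : 0 ≤ 8 * Real.pi ^ 2 * loT lo Λ c ν n * Torus.freqNormSq ℓ * (t - s) := by positivity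
      linarith
    linarith
  have hmode' : ∀ ℓ ∈ S, ∀ v : V2, v ∈ Torus.divFreeL2 (Fin 3) →
      (∀ k', k' ≠ ℓ → k' ≠ -ℓ → mFourierCoeff (EuclideanSpace.complexify ∘ ⇑v) k' = 0) →
      ‖mFourierCoeff (EuclideanSpace.complexify ∘ ⇑(U s t v - T s t v)) ℓ‖ ≤ (η * dd ℓ) * ‖mFourierCoeff (EuclideanSpace.complexify ∘ ⇑v) ℓ‖ :=
    fun ℓ hℓ v hv hvs => hmode ℓ hℓ v hv hvs
  have key := PropagatorSymm.abs_inner_sub_le_sqrt_of_modewise S (U s t) (T s t) (fun ℓ => η * dd ℓ) hnpos halone hnsc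
    (fun ℓ => mul_nonneg hη0 (hdd0 ℓ)) (fun y => hU.apply_eq_apply_starProjection s t y) (fun y => hT.apply_eq_apply_starProjection s t y)
    hUcl hTcl hmode' dd η hη0 hdd0 (fun ℓ _ => le_rfl) x ζ hx hζ
  -- the weighted sums are dominated by the coarse losses
  have hF : ∑ k' ∈ S, dd k' * ‖mFourierCoeff (EuclideanSpace.complexify ∘ ⇑x) k'‖ ^ 2 ≤ lossFwd (T s t) x :=
    sum_weight_le_lossFwd hcoarse hloT (fun _ _ => rfl) hT hs hst.le htT S x
  have hA : ∑ k' ∈ S, dd k' * ‖mFourierCoeff (EuclideanSpace.complexify ∘ ⇑ζ) k'‖ ^ 2 ≤ lossAdj (T s t) ζ :=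
    sum_weight_le_lossAdj hcoarse hloT hT hs hst.le htT S ζ
  refine key.trans ?_
  have h1 := Real.sqrt_le_sqrt hF
  have h2 := Real.sqrt_le_sqrt hA
  exact mul_le_mul (mul_le_mul_of_nonneg_left h1 hη0) h2 (Real.sqrt_nonneg _) (mul_nonneg hη0 (Real.sqrt_nonneg _))

set_option maxHeartbeats 1600000 in
/-- **Window-local (ss) on nonzero slow data ⇒ (ss)** (the body of `blockBound_slow_of_slowNZ_at` at ONE window `(s,t)`: the constant mode is fixed by
both members and decouples). -/
theorem abs_inner_sub_le_slow_of_slowNZ_window {k : ℕ} (W : LatticeShear.LatticeWord k) (M : ℝ) (hM : 0 < M) {c : ℝ} (hc : 0 < c)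
    (Φ : ℝ → Torus.Visc4 (Fin 3) → Torus.Visc4 (Fin 3)) {lo hi Λ σ' C₁ ν₀ K : ℝ} (hlo : 0 < lo) (hK : 0 < K) (hC₁ : 0 ≤ C₁)
    {ν : ℝ} (hν : ν ∈ Set.Ioo 0 ν₀) {n : ℕ} (hn : (⌈K / ν⌉₊ : ℝ) ≤ n) {𝔸 : Torus.Visc4 (Fin 3)}
    (hwin : ∃ lam ∈ Set.Icc (1:ℝ) Λ, Torus.NearIso 𝔸 (ν * (lo / lam)) (ν * (hi * lam)))
    (hΦw : ∃ lam ∈ Set.Icc (1:ℝ) Λ, Torus.NearIso (Φ ν ((1 / ν) • 𝔸)) (lo / lam) (hi * lam))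
    {Tw : ℝ} {U T : ℝ → ℝ → (V2 →L[ℝ] V2)}
    (hU : Torus.IsPropagator Tw (cellField W M hM ν hν.1 n) ((1 / (n:ℝ) ^ 2) • 𝔸) U)
    (hT : Torus.IsPropagator Tw (fun _ _ => 0) ((1 / (n:ℝ) ^ 2) • (𝔸 + (c / ν) • Φ ν ((1 / ν) • 𝔸))) T)
    {s t : ℝ} (hs : 0 ≤ s) (hst : s < t) (htT : t ≤ Tw)
    (B : ∀ x' ζ' : V2, IsSlowNZ n x' → IsSlowNZ n ζ' →
      |⟪U s t x' - T s t x', ζ'⟫_ℝ| ≤ (C₁ * (C₁ * (ν ^ σ' + ((⌈K / ν⌉₊ : ℝ) / n) ^ σ') + (min 1 ((M * W.period / ν) / (t - s))) ^ σ')) * Real.sqrt (lossFwd (T s t) x') * Real.sqrt (lossAdj (T s t) ζ'))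
    (x ζ : V2) (hx : IsSlow n x) (hζ : IsSlow n ζ) :
    |⟪U s t x - T s t x, ζ⟫_ℝ| ≤ (C₁ * (C₁ * (ν ^ σ' + ((⌈K / ν⌉₊ : ℝ) / n) ^ σ') + (min 1 ((M * W.period / ν) / (t - s))) ^ σ')) * Real.sqrt (lossFwd (T s t) x) * Real.sqrt (lossAdj (T s t) ζ) := by
  -- member facts
  have hn1 : (1:ℝ) ≤ n := by
    have h1 : (1:ℝ) ≤ ⌈K / ν⌉₊ := by
      have : 0 < K / ν := div_pos hK hν.1
      exact_mod_cast Nat.one_le_iff_ne_zero.2 (Nat.pos_iff_ne_zero.1 (Nat.ceil_pos.2 this))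
    exact h1.trans hn
  have hnpos : 0 < n := by exact_mod_cast (show (0:ℝ) < n by linarith)
  have hLN : 2 * (n / 4) < n := by omega
  obtain ⟨lam, hlam, hA𝔸⟩ := hwin
  obtain ⟨lam', hlam', hΦn⟩ := hΦw
  have hlam0 : 0 < lam := by linarith [hlam.1]
  have hlam'0 : 0 < lam' := by linarith [hlam'.1]
  have hcν : 0 ≤ c / ν := div_nonneg hc.le hν.1.le
  have hn2 : (0:ℝ) < 1 / (n:ℝ) ^ 2 := by positivity
  have hcell : Torus.NearIso ((1 / (n:ℝ) ^ 2) • 𝔸) ((1 / (n:ℝ) ^ 2) * (ν * (lo / lam))) ((1 / (n:ℝ) ^ 2) * (ν * (hi * lam))) :=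
    hA𝔸.smul hn2.le
  have hcell_lo : 0 < (1 / (n:ℝ) ^ 2) * (ν * (lo / lam)) := mul_pos hn2 (mul_pos hν.1 (div_pos hlo hlam0))
  have hcoarse : Torus.NearIso ((1 / (n:ℝ) ^ 2) • (𝔸 + (c / ν) • Φ ν ((1 / ν) • 𝔸)))
      ((1 / (n:ℝ) ^ 2) * (ν * (lo / lam) + (c / ν) * (lo / lam'))) ((1 / (n:ℝ) ^ 2) * (ν * (hi * lam) + (c / ν) * (hi * lam'))) :=
    (hA𝔸.add (hΦn.smul hcν)).smul hn2.le
  have hcoarse_lo : 0 < (1 / (n:ℝ) ^ 2) * (ν * (lo / lam) + (c / ν) * (lo / lam')) := by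
    have h1 : 0 < ν * (lo / lam) := mul_pos hν.1 (div_pos hlo hlam0)
    have h2 : 0 ≤ (c / ν) * (lo / lam') := mul_nonneg hcν (div_pos hlo hlam'0).le
    exact mul_pos hn2 (by linarith)
  have hbU : MemLp (Torus.stLift (cellField W M hM ν hν.1 n)) ∞ (volume.restrict (Ioo 0 Tw ×ˢ (univ : Set (EuclideanSpace ℝ (Fin 3))))) :=
    memLp_top_stLift_cell _ n Tw
  have hbUdiv : ∀ᵐ τ ∂(volume.restrict (Ioo (0:ℝ) Tw)), Torus.IsWeaklyDivFree (cellField W M hM ν hν.1 n τ) :=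
    ae_of_all _ fun τ => (isDivFree_cell _ n τ).isWeaklyDivFree_holds (isSmooth_cell _ n τ)
  have hbT : MemLp (Torus.stLift (fun (_ : ℝ) (_ : UnitAddTorus (Fin 3)) => (0 : EuclideanSpace ℝ (Fin 3)))) ∞
      (volume.restrict (Ioo 0 Tw ×ˢ (univ : Set (EuclideanSpace ℝ (Fin 3))))) := memLp_top_const 0
  have hbTdiv : ∀ᵐ τ ∂(volume.restrict (Ioo (0:ℝ) Tw)),
      Torus.IsWeaklyDivFree ((fun (_ : ℝ) (_ : UnitAddTorus (Fin 3)) => (0 : EuclideanSpace ℝ (Fin 3))) τ) :=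
    ae_of_all _ fun τ θ hθ => by simp
  have hgrid : ∀ (j : Fin 3 → Fin n) (τ : ℝ) (y : UnitAddTorus (Fin 3)),
      cellField W M hM ν hν.1 n τ (y + (fun i => ((((j i : ℕ) : ℝ) / n : ℝ) : UnitAddCircle))) = cellField W M hM ν hν.1 n τ y :=
    fun j τ y => by unfold cellField; exact cell_add_grid _ hnpos j τ y
  have hsupp := coarseSupp Tw _ _ _ hcoarse_lo hcoarse T hT s t hs hst.le htT
  -- the split at the zero mode
  set A0 : Set (Fin 3 → ℤ) := {0} with hA0
  obtain ⟨P0, hP0⟩ := exists_labelProj A0 (fun k' => by rw [hA0]; simp)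
  have hP0on : ∀ y : V2, fc (P0 y) 0 = fc y 0 := fun y => by have h := hP0 y 0; rw [if_pos (by rw [hA0]; simp)] at h; exact h
  have hP0off : ∀ (y : V2) k', k' ≠ 0 → fc (P0 y) k' = 0 := fun y k' hk' => by
    have h := hP0 y k'; rw [if_neg (by rw [hA0]; simpa using hk')] at h; exact h
  set x₀ : V2 := P0 x with hx₀
  set x' : V2 := x - P0 x with hx'
  set ζ₀ : V2 := P0 ζ with hζ₀
  set ζ' : V2 := ζ - P0 ζ with hζ'
  have hxsplit : x = x₀ + x' := by rw [hx₀, hx']; abel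
  have hζsplit : ζ = ζ₀ + ζ' := by rw [hζ₀, hζ']; abel
  have nz_of : ∀ y : V2, IsSlow n y → IsSlowNZ n (y - P0 y) := by
    intro y hy k' hk'
    rw [fc_sub]
    by_cases h0 : k' = 0
    · subst h0; rw [hP0on, sub_self]
    · rw [hP0off y k' h0, sub_zero]
      exact hy k' fun hmem => hk' (Finset.mem_erase.2 ⟨h0, hmem⟩)
  have hx'nz : IsSlowNZ n x' := nz_of x hx
  have hζ'nz : IsSlowNZ n ζ' := nz_of ζ hζ
  have hx'0 : fc x' 0 = 0 := hx'nz 0 (by simp)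
  have hζ'0 : fc ζ' 0 = 0 := hζ'nz 0 (by simp)
  -- the constant parts are fixed by both members
  have hUx₀ : U s t x₀ = x₀ := apply_eq_self_of_supp_zero hcell hcell_lo hbU hbUdiv hU hs hst.le htT x₀ (hP0off x)
  have hTx₀ : T s t x₀ = x₀ := apply_eq_self_of_supp_zero hcoarse hcoarse_lo hbT hbTdiv hT hs hst.le htT x₀ (hP0off x)
  -- the zero mode of `(U−T)x'` vanishes: `x'` has no coefficient on the class pair of `0`
  have hx'class : ∀ k', ((∀ i, (n:ℤ) ∣ k' i - (0 : Fin 3 → ℤ) i) ∨ (∀ i, (n:ℤ) ∣ k' i + (0 : Fin 3 → ℤ) i)) →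
      mFourierCoeff (EuclideanSpace.complexify ∘ ⇑x') k' = 0 := by
    intro k' hk'
    by_cases hmem : k' ∈ (Torus.freqBall (d := Fin 3) (n / 4)).erase 0
    · have hk'ball := Finset.mem_of_mem_erase hmem
      have h0ball : (0 : Fin 3 → ℤ) ∈ Torus.freqBall (d := Fin 3) (n / 4) := by
        rw [Torus.mem_freqBall]; simp [Torus.freqNormSq]
      rcases FlatWindow.alone_of_lt hLN h0ball hk'ball hk' with h | h
      · exact absurd h (Finset.ne_of_mem_erase hmem)
      · exact absurd (by simpa using h) (Finset.ne_of_mem_erase hmem)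
    · exact hx'nz k' hmem
  have hUx'0 : fc (U s t x') 0 = 0 :=
    PropagatorSymm.fcoeff_apply_eq_zero_of_classes hU hcell hcell_lo hbU hbUdiv hnpos hgrid 0 hs hst.le htT x' hx'class 0 (Or.inl fun i => by simp)
  have hTx'0 : fc (T s t x') 0 = 0 := (hsupp x' 0 hx'0).1
  have hdiff0 : fc (U s t x' - T s t x') 0 = 0 := by rw [fc_sub, hUx'0, hTx'0, sub_self]
  -- the pairing reduces to the nonzero parts
  have hpair : ⟪U s t x - T s t x, ζ⟫_ℝ = ⟪U s t x' - T s t x', ζ'⟫_ℝ := by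
    have e1 : U s t x - T s t x = U s t x' - T s t x' := by
      rw [hxsplit, map_add, map_add, hUx₀, hTx₀]; abel
    rw [e1, hζsplit, inner_add_right]
    have hz : ⟪U s t x' - T s t x', ζ₀⟫_ℝ = 0 := by
      refine inner_eq_zero_of_fc_disjoint fun k' => ?_
      by_cases h0 : k' = 0
      · subst h0; exact Or.inl hdiff0
      · exact Or.inr (hP0off ζ k' h0)
    rw [hz, zero_add]
  -- the block on the nonzero parts
  have hB := B x' ζ' hx'nz hζ'nz
  -- losses only grow: `q_T(x') ≤ q_T(x)`, `q*_T(ζ') ≤ q*_T(ζ)`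
  have hTc : ∀ y, ‖T s t y‖ ≤ ‖y‖ := hT.norm_le s t
  have hox : ⟪x₀, x'⟫_ℝ = 0 := inner_eq_zero_of_fc_disjoint fun k' => by
    by_cases h0 : k' = 0
    · subst h0; exact Or.inr hx'0
    · exact Or.inl (hP0off x k' h0)
  have hoTx : ⟪T s t x₀, T s t x'⟫_ℝ = 0 := inner_eq_zero_of_fc_disjoint fun k' => by
    by_cases h0 : k' = 0
    · subst h0; exact Or.inr hTx'0
    · exact Or.inl ((hsupp x₀ k' (hP0off x k' h0)).1)
  have hoζ : ⟪ζ₀, ζ'⟫_ℝ = 0 := inner_eq_zero_of_fc_disjoint fun k' => by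
    by_cases h0 : k' = 0
    · subst h0; exact Or.inr hζ'0
    · exact Or.inl (hP0off ζ k' h0)
  have hoAζ : ⟪ContinuousLinearMap.adjoint (T s t) ζ₀, ContinuousLinearMap.adjoint (T s t) ζ'⟫_ℝ = 0 :=
    inner_eq_zero_of_fc_disjoint fun k' => by
      by_cases h0 : k' = 0
      · subst h0; exact Or.inr ((hsupp ζ' 0 hζ'0).2)
      · exact Or.inl ((hsupp ζ₀ k' (hP0off ζ k' h0)).2)
  have hq : lossFwd (T s t) x' ≤ lossFwd (T s t) x := by
    have hadd : lossFwd (T s t) x = lossFwd (T s t) x₀ + lossFwd (T s t) x' := by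
      unfold lossFwd; rw [hxsplit]; exact loss_add_of_orthogonal hox hoTx
    have h0 : 0 ≤ lossFwd (T s t) x₀ := loss_nonneg hTc x₀
    rw [hadd]; linarith
  have hqs : lossAdj (T s t) ζ' ≤ lossAdj (T s t) ζ := by
    have hadd : lossAdj (T s t) ζ = lossAdj (T s t) ζ₀ + lossAdj (T s t) ζ' := by
      unfold lossAdj; rw [hζsplit]; exact loss_add_of_orthogonal hoζ hoAζ
    have h0 : 0 ≤ lossAdj (T s t) ζ₀ := lossAdj_nonneg hTc ζ₀
    rw [hadd]; linarith
  have hP0' : 0 ≤ (M * W.period / ν) / (t - s) :=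
    div_nonneg (div_nonneg (mul_nonneg hM.le
      (Summit.AnomalousDissipation.AnomalousDissipation.Theorems.SolenoidalFractalHomogenisation.PermissibleCarrier.period_pos W).le) hν.1.le)
      (by linarith)
  have hη0 : 0 ≤ C₁ * (C₁ * (ν ^ σ' + ((⌈K / ν⌉₊ : ℝ) / n) ^ σ') + (min 1 ((M * W.period / ν) / (t - s))) ^ σ') := by
    have h1 : 0 ≤ ν ^ σ' := Real.rpow_nonneg hν.1.le _
    have h2 : 0 ≤ ((⌈K / ν⌉₊ : ℝ) / n) ^ σ' := Real.rpow_nonneg (by positivity) _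
    have h3 : 0 ≤ (min 1 ((M * W.period / ν) / (t - s))) ^ σ' := Real.rpow_nonneg (le_min zero_le_one hP0') _
    exact mul_nonneg hC₁ (by positivity)
  rw [hpair]
  refine hB.trans ?_
  exact mul_le_mul (mul_le_mul_of_nonneg_left (Real.sqrt_le_sqrt hq) hη0) (Real.sqrt_le_sqrt hqs) (Real.sqrt_nonneg _)
    (mul_nonneg hη0 (Real.sqrt_nonneg _))

/-! ## §2 The (ss) block inequality on grid-anchored windows -/

set_option maxHeartbeats 1600000 in
/-- **The (ss) block on slow data, grid-anchored windows** (= the body of `BlockBound … (e σ) C₁ … IsSlow IsSlow` with the extra binder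
`∃ j : ℕ, s = j·(M·W.period/ν)`), for every exponent map `0 ≤ e(σ) ≤ min(σ/2, 1/2)`. -/
theorem inner_sub_le_slow_grid (e : ℝ → ℝ) (he : ∀ σ, 0 < σ → 0 ≤ e σ ∧ e σ ≤ σ / 2 ∧ e σ ≤ 1 / 2) :
    ∀ k (W : LatticeShear.LatticeWord k) (M : ℝ) (hM : 0 < M) (c : ℝ), 0 < c →
    ∀ (Φ : ℝ → Torus.Visc4 (Fin 3) → Torus.Visc4 (Fin 3)) (lo hi Λ β σ C ν₀ K : ℝ),
    0 < lo → lo ≤ 1 → 1 ≤ hi → 1 < Λ → 0 ≤ β → 0 < σ → 0 ≤ C → 0 < ν₀ → ν₀ ≤ 1 → 0 < K →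
    SlowVectorClauseF W M hM c Φ lo hi Λ β σ C ν₀ K →
    (∀ Kb : ℝ, 1 ≤ Kb → ∃ CK : ℝ, 1 ≤ CK ∧ ∃ cK > (0:ℝ), ∃ νh > (0:ℝ), HighLabelDecayW W M hM lo hi Λ β νh Kb CK cK) →
    ∃ C₁ : ℝ, C ≤ C₁ ∧
    ∀ ν, ∀ hν : ν ∈ Set.Ioo 0 ν₀, ∀ n : ℕ, (⌈K / ν⌉₊ : ℝ) ≤ n → ∀ 𝔸 : Torus.Visc4 (Fin 3),
      Torus.OddSmall 𝔸 (ν * β) → (∃ lam ∈ Set.Icc (1:ℝ) Λ, Torus.NearIso 𝔸 (ν * (lo / lam)) (ν * (hi * lam))) →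
      Torus.OddSmall (Φ ν ((1 / ν) • 𝔸)) β → (∃ lam ∈ Set.Icc (1:ℝ) Λ, Torus.NearIso (Φ ν ((1 / ν) • 𝔸)) (lo / lam) (hi * lam)) →
      ∀ Tw > (0:ℝ), ∀ U T : ℝ → ℝ → (V2 →L[ℝ] V2),
        Torus.IsPropagator Tw (cellField W M hM ν hν.1 n) ((1 / (n:ℝ) ^ 2) • 𝔸) U →
        Torus.IsPropagator Tw (fun _ _ => 0) ((1 / (n:ℝ) ^ 2) • (𝔸 + (c / ν) • Φ ν ((1 / ν) • 𝔸))) T →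
      ∀ s t : ℝ, 0 ≤ s → s < t → t ≤ Tw → (∃ j : ℕ, s = j * (M * W.period / ν)) →
      ∀ x ζ : V2, IsSlow n x → IsSlow n ζ →
        |⟪U s t x - T s t x, ζ⟫_ℝ| ≤ (C₁ * (C₁ * (ν ^ e σ + ((⌈K / ν⌉₊ : ℝ) / n) ^ e σ) + (min 1 ((M * W.period / ν) / (t - s))) ^ e σ)) * Real.sqrt (lossFwd (T s t) x) * Real.sqrt (lossAdj (T s t) ζ) := by
  intro k W M hM c hc Φ lo hi Λ β σ C ν₀ K hlo hlo1 hhi hΛ hβ hσ hC hν₀ hν₀1 hK hV hHfam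
  obtain ⟨C₁, hCC₁, hmain⟩ :=
    VmodGen.ssMode_grid e he k W M hM c hc Φ lo hi Λ β σ C ν₀ K hlo hlo1 hhi hΛ hβ hσ hC hν₀ hν₀1 hK hV hHfam
  refine ⟨C₁, hCC₁, ?_⟩
  intro ν hν n hn 𝔸 hodd hwin hΦo hΦw Tw hTw U T hU hT s t hs hst htT hgrid x ζ hx hζ
  have hC₁0 : 0 ≤ C₁ := hC.trans hCC₁
  refine abs_inner_sub_le_slow_of_slowNZ_window W M hM hc Φ hlo hK hC₁0 hν hn hwin hΦw hU hT hs hst htT ?_ x ζ hx hζ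
  intro x' ζ' hx' hζ'
  exact abs_inner_sub_le_of_ssMode_window W M hM hc Φ hlo hΛ hK hC₁0 hν hn hwin hΦw hU hT hs hst htT
    (fun ℓ hℓ v hv hvs => hmain ν hν n hn 𝔸 hodd hwin hΦo hΦw Tw hTw U T hU hT s t hs hst htT hgrid ℓ hℓ v hv hvs) x' ζ' hx' hζ'

end Summit.AnomalousDissipation.AnomalousDissipation.Theorems.SolenoidalFractalHomogenisation.LagrangianStep.VmodFlat

end
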